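import Literature.Geometry.DiscreteGeometry.SphericalCodeOptimal
import Literature.Geometry.DiscreteGeometry.TammesThirteen
import Literature.Geometry.DiscreteGeometry.TammesThirteenLowerBound
import HarnessLib

/-!
# `musinTarasov2012_tammes_thirteen` in the language of the Tammes number `d₁₃` — proved glue

Theorem-only companion of `SphericalCodeOptimal.lean` (ψ, `d_N = maxMinDist`, maximal
arrangements) for the named fact of `TammesThirteen.lean`: the fact is EQUIVALENT to the chordal
inequality `d₁₃ < 0.957` (`musinTarasov2012_tammes_thirteen_iff_maxMinDist_lt`), and the explicit
arrangement `P₁₃` of `TammesThirteenLowerBound.lean` gives `d₁₃ ≥ 0.9564136`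
(`le_maxMinDist_thirteen`).  Musin–Tarasov's Theorem 1 is `d₁₃ = δ₁₃ ≈ 57.1367°`, chord
`0.95641…`; the upper bound `d₁₃ < 0.957` is the computer-assisted part (§4 of the paper) and is
NOT proved here.

## References
* O. R. Musin, A. S. Tarasov, Discrete Comput. Geom. 48 (2012) 128–141, Theorem 1, §1.2.
  [`MusinTarasov2012`]
-/

noncomputable section

namespace Literature.Geometry.DiscreteGeometry

open Finset

/-- **The tree's named fact in the language of `d_N`.**  `musinTarasov2012_tammes_thirteen`
(every finite set of unit vectors of `ℝ³` with pairwise distances `≥ 0.957` has `≤ 12` elements)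
is EQUIVALENT to `d₁₃ < 0.957` (chordal), i.e. to `d₁₃ < 57.17…°` — Musin–Tarasov's Theorem 1
gives `d₁₃ = δ₁₃ ≈ 57.1367°` (chord `0.95641…`).  This is a proved reformulation, not a proof.
[cite: MusinTarasov2012, Theorem 1 and §1.2] -/
theorem musinTarasov2012_tammes_thirteen_iff_maxMinDist_lt :
    musinTarasov2012_tammes_thirteen ↔
      maxMinDist 13 (EuclideanSpace ℝ (Fin 3)) < (0.957 : ℝ) := by
  constructor
  · intro h
    obtain ⟨x, hx, he⟩ := exists_minDist_eq_maxMinDist (E := EuclideanSpace ℝ (Fin 3)) 13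
    rw [← he]
    by_contra hge
    push Not at hge
    have hne : (distinctPairs 13).Nonempty := distinctPairs_nonempty (i := 0) (j := 1) (by decide)
    obtain ⟨T, hTc, hT1, hTd⟩ := exists_finset_of_le_minDist hx hne (by norm_num) hge
    have := h T hT1 hTd
    omega
  · intro h T hT1 hTd
    by_contra hc
    push Not at hc
    obtain ⟨T', hT'T, hcard⟩ := Finset.exists_subset_card_eq (show 13 ≤ T.card by omega)
    obtain ⟨v, hv, w, hw, hvw, hd⟩ :=
      exists_dist_le_maxMinDist (T := T') (fun v hv => hT1 v (hT'T hv)) (by omega)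
    rw [hcard] at hd
    have := hTd v (hT'T hv) w (hT'T hw) hvw
    linarith

/-- **Lower bound `d₁₃ ≥ 0.9564136`** (chord of `57.1367°`), from the explicit arrangement `P₁₃`
of `TammesThirteenLowerBound.lean`. [cite: MusinTarasov2012, Theorem 1 (the arrangement P₁₃)] -/
theorem le_maxMinDist_thirteen :
    (0.9564136 : ℝ) ≤ maxMinDist 13 (EuclideanSpace ℝ (Fin 3)) := by
  obtain ⟨T, hTc, hT1, hTd⟩ := tammes_thirteen_lower_bound
  set x : Fin 13 → EuclideanSpace ℝ (Fin 3) := fun i => (T.equivFin.symm (Fin.cast hTc.symm i) : _)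
    with hxdef
  have hx : x ∈ unitConfigs 13 (EuclideanSpace ℝ (Fin 3)) := fun i => hT1 _ (T.equivFin.symm _).2
  have hne : (distinctPairs 13).Nonempty := distinctPairs_nonempty (i := 0) (j := 1) (by decide)
  have hψ : (0.9564136 : ℝ) ≤ minDist x := by
    refine le_minDist x hne fun i j hij => hTd _ (T.equivFin.symm _).2 _ (T.equivFin.symm _).2 ?_
    intro h
    apply hij
    have := T.equivFin.symm.injective (Subtype.val_injective h)
    exact Fin.cast_injective _ this
  exact hψ.trans (minDist_le_maxMinDist hx)

end Literature.Geometry.DiscreteGeometry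

end
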